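import Literature.NumberTheory.EllipticCurves.TateCurve.TorsionRoot
import Literature.NumberTheory.EllipticCurves.TateCurve.Twist
import Literature.NumberTheory.EllipticCurves.TateCurve.UniformizationProofs
import Literature.NumberTheory.EllipticCurves.TateCurve.UniformizationSubfield
import Literature.NumberTheory.EllipticCurves.TateCurve.UniformizationTransport
import Mathlib.Analysis.Normed.Unbundled.SpectralNorm
import Mathlib.RingTheory.Norm.Defs
import HarnessLib

/-!
# Rational `n`-torsion with `n` ODD forces the Tate parameter to be an `n`-th power — with NO
# splitness hypothesis (Silverman ATAEC V.5.3 over a quadratic twist field, then a norm argument)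

Topic `Literature/NumberTheory/EllipticCurves/TateCurve`, namespace
`Literature.NumberTheory.EllipticCurves.TateCurve` (abc-iut cell, classical support for the residual
«`q̲_v = q_v^{1/2l} ∈ K_v̲`» of [IUTchI] Ex. 3.2 (iv); companion of `TorsionRoot.lean`, abc-iut-w5-d209).

`TorsionRoot.lean` proves: if `E(K)` is `K`-isomorphic to the Tate curve `E_q` (SPLIT multiplicative
reduction) and has `n²` distinct points killed by `n`, then `q` is an `n`-th power in `K`. Here the
`K`-isomorphism is NOT assumed: for ANY elliptic curve `E/K` over a complete ultrametric field of
characteristic `0` with `|j(E)| > 1` (so `E` is, over `K̄`, the Tate curve `E_q` with `tateJ q = j(E)`,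
Silverman ATAEC Thm. V.5.3 (a) — split OR non-split multiplicative reduction), `n²` distinct `K`-rational
points killed by an ODD `n` still force `q ∈ (K^×)^n` (`exists_pow_eq_tateParameter_of_odd_torsion`).

Proof (classical). Let `γ = -c₄(E)/c₆(E)` (Silverman's `γ(E/K) ∈ K^*/K^{*2}`, ATAEC Lemma V.5.2) and
let `L = K(√γ) ⊆ K̄`, a field extension of degree `≤ 2`, complete for the spectral norm. Over `L`,
`γ(E/L) = γ` IS a square, so by the tree's PROVED (ii) ⇒ (i) of ATAEC Thm. V.5.3 (b)
(`iso_tateCurve_of_isSquare_gamma`, over `L`) `E ≅_L E_q`; the `K`-points of `E` inject into its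
`L`-points, so `TorsionRoot.exists_pow_eq_of_torsion_of_variableChange` (over `L`) gives `r ∈ L` with
`rⁿ = q`. Taking norms, `N_{L/K}(r)ⁿ = q^{[L:K]}` with `[L:K] ∈ {1, 2}` coprime to the odd `n`, and a
Bezout combination (`exists_pow_eq_of_pow_eq_pow_of_coprime`) produces `ρ ∈ K` with `ρⁿ = q`.

Why this matters for the cell (consumer side only; nothing of [IUTchI–IV] is asserted): the residual
input named by `Summits/ABC/IUTFork/Thm311RealTate.lean` §3 («`qroot` … existence lemma») and by
`Literature/IUT/LogVolume/GenuineLogTheta.lean` (`ThetaVolumeInput`: «an inhabitant carries `2l`-th roots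
of the Tate parameters in `K_v̲`») splits into an `l`-part and a `2`-part; for the ODD prime `l` of the
initial Θ-data (`E_F[l] ⊆ E_F(K)`, `K := F(E_F[l])`, [IUTchI] Def. 3.1 (c)) this file shows that the
`l`-part — `q_v ∈ (K_v̲^×)^l`, hence `l ∣ ord_v̲(q_v)` — needs NO prior proof that the multiplicative
reduction at `v̲` is split. (The `2`-part does: it is not treated here.)

## References
* [SilvermanATAEC1994] J. H. Silverman, *Advanced Topics in the Arithmetic of Elliptic Curves*,
  GTM 151, Springer 1994, Lemma V.5.2, Thm. V.5.3 (PDF pp. 406–409), Thm. V.3.1 (c) (PDF p. 395).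
* [Mochizuki2012] S. Mochizuki, *Inter-universal Teichmüller theory I*, Example 3.2 (iv), kurims p. 71
  (consumer only).
-/

noncomputable section

open scoped Classical

namespace Literature.NumberTheory.EllipticCurves.TateCurve

open WeierstrassCurve Polynomial SteinWuthrich2013

universe u

/-! ### Bezout: `Nⁿ = q^d` with `gcd(n, d) = 1` gives an `n`-th root of `q` -/

/-- **`Nⁿ = q^d`, `q ≠ 0`, `gcd(n,d) = 1` ⇒ `q` is an `n`-th power**: with `n·A + d·B = 1` (Bezout over
`ℤ`), `ρ := q^A · N^B` has `ρⁿ = q^{nA} · q^{dB} = q`. (Used with `N = N_{L/K}(r)`, `d = [L:K]`.)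
[cite: SilvermanATAEC1994, Thm. V.5.3 (PDF pp. 407–409)] -/
theorem exists_pow_eq_of_pow_eq_pow_of_coprime {F : Type*} [Field F] {q N : F} {n d : ℕ} (hq : q ≠ 0)
    (hnd : n.Coprime d) (h : N ^ n = q ^ d) : ∃ r : F, r ^ n = q := by
  have hbez : (n : ℤ) * Nat.gcdA n d + (d : ℤ) * Nat.gcdB n d = 1 := by
    rw [← Nat.gcd_eq_gcd_ab n d, Nat.Coprime.gcd_eq_one hnd, Nat.cast_one]
  refine ⟨q ^ Nat.gcdA n d * N ^ Nat.gcdB n d, ?_⟩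
  rw [← zpow_natCast, mul_zpow, ← zpow_mul, ← zpow_mul]
  have e2 : N ^ (Nat.gcdB n d * (n : ℤ)) = q ^ ((d : ℤ) * Nat.gcdB n d) := by
    rw [mul_comm, zpow_mul, zpow_natCast, h, ← zpow_natCast, ← zpow_mul]
  rw [e2, ← zpow_add₀ hq, show Nat.gcdA n d * (n : ℤ) + (d : ℤ) * Nat.gcdB n d = 1 by
    rw [← hbez]; ring, zpow_one]

/-! ### Transport of `j` along an equality of curves -/

/-- `j` is invariant under (propositional) equality of elliptic curves — `rw` cannot move the
`IsElliptic` instance, so we record the `subst` once. [folklore] -/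
private theorem j_eq_of_eq {R : Type*} [CommRing R] {W W' : WeierstrassCurve R} [W.IsElliptic] [W'.IsElliptic]
    (h : W = W') : W.j = W'.j := by
  subst h
  rfl

/-! ### The theorem -/

section Tate

variable {K : Type u} [NontriviallyNormedField K] [CompleteSpace K] [IsUltrametricDist K]
  [CharZero K]

omit [CompleteSpace K] [IsUltrametricDist K] [CharZero K] in
/-- The base change of the `K`-rational points of `E` to an extension field `L` as an (injective)
homomorphism `E(K) →+ E_L(L)` (Mathlib `WeierstrassCurve.Affine.Point.map` along `K →ₐ[K] L`, read on
`E.toAffine.Point` via `E.baseChange K = E`). [folklore] -/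
private theorem exists_injective_addMonoidHom_baseChange (E : WeierstrassCurve K) (L : Type u) [Field L]
    [Algebra K L] [DecidableEq L] :
    ∃ f : E.toAffine.Point →+ (E.baseChange L).toAffine.Point, Function.Injective f := by
  have hEK : E.baseChange K = E := E.map_id
  have e : E.toAffine.Point ≃+ (E.baseChange K).toAffine.Point := by rw [hEK]
  exact ⟨(Affine.Point.map (W' := E) (Algebra.ofId K L)).comp e.toAddMonoidHom,
    (Affine.Point.map_injective (W' := E) (f := Algebra.ofId K L)).comp e.injective⟩

/-- **Rational `n`-torsion, `n` odd, forces `q ∈ (K^×)ⁿ` — no splitness needed.** For an elliptic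
curve `E` over a complete ultrametric field `K` of characteristic `0` with `|j(E)| > 1`, Tate parameter
`q` (`q ≠ 0`, `‖q‖ < 1`, `tateJ q = j(E)`): if `E(K)` contains `n²` distinct points killed by an ODD
`n`, then `q = ρⁿ` for some `ρ ∈ K`. Silverman ATAEC Thm. V.5.3: over `L = K(√γ(E/K))` (degree `≤ 2`)
the curve becomes `L`-isomorphic to `E_q` ((ii) ⇒ (i) of V.5.3 (b)), the torsion count gives an `n`-th
root of `q` in `L` (V.3.1 (c), `TorsionRoot`), and the norm `N_{L/K}` brings it down to `K` since
`gcd(n, [L:K]) = 1`. [cite: SilvermanATAEC1994, Thm. V.5.3 (PDF pp. 407–409)] -/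
theorem exists_pow_eq_tateParameter_of_odd_torsion (E : WeierstrassCurve K) [E.IsElliptic] {q : K}
    (hj : 1 < ‖E.j‖) (hq0 : q ≠ 0) (hq : ‖q‖ < 1) (hqj : tateJ q = E.j) {n : ℕ} (hn : Odd n)
    (S : Finset E.toAffine.Point) (hS : ∀ P ∈ S, n • P = 0) (hcard : n ^ 2 ≤ S.card) :
    ∃ r : K, r ^ n = q := by
  -- `K̄` with the spectral norm (the setting of the tree's `uniformization_holds`)
  letI : NontriviallyNormedField (AlgebraicClosure K) :=
    spectralNorm.nontriviallyNormedField K (AlgebraicClosure K)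
  letI : NormedAlgebra K (AlgebraicClosure K) := spectralNorm.normedAlgebra K (AlgebraicClosure K)
  haveI : IsUltrametricDist (AlgebraicClosure K) :=
    IsUltrametricDist.isUltrametricDist_of_isNonarchimedean_norm
      (isNonarchimedean_spectralNorm (K := K) (L := AlgebraicClosure K))
  -- `γ = -c₄/c₆`, a square root `w` of it in `K̄`, and `L = K(w)`
  obtain ⟨w, hw⟩ := IsAlgClosed.exists_pow_nat_eq (algebraMap K (AlgebraicClosure K) (-(E.c₄ / E.c₆)))
    two_pos
  have hwint : IsIntegral K w := (Algebra.IsAlgebraic.isAlgebraic (R := K) w).isIntegral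
  set L : IntermediateField K (AlgebraicClosure K) := IntermediateField.adjoin K {w} with hLdef
  haveI : FiniteDimensional K L := IntermediateField.adjoin.finiteDimensional hwint
  letI : NontriviallyNormedField L := IntermediateField.nontriviallyNormedField L
  haveI : CompleteSpace L := completeSpace_intermediateField K L
  haveI : IsUltrametricDist L := IntermediateField.isUltrametricDist L
  haveI : CharZero L := IntermediateField.charZero' (K := K) L
  -- `[L : K] ∈ {1, 2}`
  have hdeg : Module.finrank K L = 1 ∨ Module.finrank K L = 2 := by
    have hle : Module.finrank K L ≤ 2 := by
      rw [hLdef, IntermediateField.adjoin.finrank hwint]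
      have hp0 : (X ^ 2 - C (-(E.c₄ / E.c₆)) : K[X]) ≠ 0 :=
        X_pow_sub_C_ne_zero (by norm_num) _
      have hpw : aeval w (X ^ 2 - C (-(E.c₄ / E.c₆)) : K[X]) = 0 := by
        rw [map_sub, aeval_X_pow, aeval_C, hw, sub_self]
      have hdeg2 : (X ^ 2 - C (-(E.c₄ / E.c₆)) : K[X]).degree = 2 := by
        rw [degree_X_pow_sub_C (by norm_num)]; rfl
      have h := minpoly.degree_le_of_ne_zero K w hp0 hpw
      rw [hdeg2] at h
      exact natDegree_le_iff_degree_le.mpr h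
    have hpos : 0 < Module.finrank K L := Module.finrank_pos
    omega
  -- the base-changed curve over `L` and the Tate parameter seen in `L`
  set qL : L := algebraMap K L q with hqLdef
  have hqL0 : qL ≠ 0 := (map_ne_zero_iff _ (algebraMap K L).injective).mpr hq0
  have hqL : ‖qL‖ < 1 := by rw [hqLdef, IntermediateField.norm_algebraMap]; exact hq
  have hjL : (E.baseChange L).j = algebraMap K L E.j := E.map_j (algebraMap K L)
  have hjL' : 1 < ‖(E.baseChange L).j‖ := by rw [hjL, IntermediateField.norm_algebraMap]; exact hj
  have hqjL : tateJ qL = (E.baseChange L).j := by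
    haveI := tateCurve_isElliptic hqL0 hqL
    haveI := tateCurve_isElliptic hq0 hq
    have h1 : tateJ qL = (tateCurve qL).j := (tateCurve_j hqL).symm
    have h2 : (tateCurve qL).j = ((tateCurve q).baseChange L).j :=
      j_eq_of_eq (tateCurve_baseChange_intermediateField L hq).symm
    have h3 : ((tateCurve q).baseChange L).j = algebraMap K L (tateCurve q).j :=
      (tateCurve q).map_j (algebraMap K L)
    rw [h1, h2, h3, tateCurve_j hq, hqj, hjL]
  -- `γ(E_L/L) = w²` is a square in `L`
  have hγL : IsSquare (-((E.baseChange L).c₄ / (E.baseChange L).c₆)) := by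
    have hwL : w ∈ L := by rw [hLdef]; exact IntermediateField.mem_adjoin_simple_self K w
    refine ⟨⟨w, hwL⟩, ?_⟩
    have hc : -((E.baseChange L).c₄ / (E.baseChange L).c₆) = algebraMap K L (-(E.c₄ / E.c₆)) := by
      have h4 : (E.baseChange L).c₄ = algebraMap K L E.c₄ := E.map_c₄ (algebraMap K L)
      have h6 : (E.baseChange L).c₆ = algebraMap K L E.c₆ := E.map_c₆ (algebraMap K L)
      rw [h4, h6, map_neg, map_div₀]
    rw [hc]
    have key : ((algebraMap K L (-(E.c₄ / E.c₆)) : L) : AlgebraicClosure K) =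
        (((⟨w, hwL⟩ : L) * ⟨w, hwL⟩ : L) : AlgebraicClosure K) := by
      rw [IntermediateField.coe_algebraMap_apply, MulMemClass.coe_mul, ← pow_two, hw]
    exact Subtype.ext key
  -- V.5.3 (b) (ii) ⇒ (i) over `L`
  obtain ⟨C, hC⟩ := iso_tateCurve_of_isSquare_gamma (E.baseChange L) hjL' hqL0 hqL hqjL hγL
  -- transport the torsion points `E(K) ↪ E(L)` and apply `TorsionRoot` over `L`
  -- (the point groups of `TorsionRoot.lean` carry the classical `DecidableEq`; use the same on `L`)
  letI : DecidableEq L := fun a b => Classical.propDecidable (a = b)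
  obtain ⟨f, hf⟩ := exists_injective_addMonoidHom_baseChange E L
  have eC : (E.baseChange L).toAffine.Point ≃+ (tateCurve qL).toAffine.Point := by
    rw [← hC]
    exact VariableChange.pointEquiv (E.baseChange L) C
  set e : E.toAffine.Point →+ (tateCurve qL).toAffine.Point := eC.toAddMonoidHom.comp f with he
  have hinj : Function.Injective e := by
    intro a b h
    rw [he, AddMonoidHom.comp_apply, AddMonoidHom.comp_apply] at h
    exact hf (eC.injective h)
  obtain ⟨rL, hrL⟩ := exists_pow_eq_of_torsion_of_injective hqL0 hqL e hinj hn.pos S hS hcard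
  -- norm down to `K`
  have hN : (Algebra.norm K rL) ^ n = q ^ Module.finrank K L := by
    rw [← map_pow, hrL, hqLdef, Algebra.norm_algebraMap]
  have hcop : n.Coprime (Module.finrank K L) := by
    rcases hdeg with h | h
    · rw [h]; exact Nat.coprime_one_right n
    · rw [h]; exact hn.coprime_two_right
  exact exists_pow_eq_of_pow_eq_pow_of_coprime hq0 hcop hN

/-- **Self-contained form.** For `E/K` with `|j(E)| > 1` and `n²` rational points killed by an odd `n`,
THE Tate parameter `q` of `E` (`0 < ‖q‖ < 1`, `tateJ q = j(E)`; it exists and is unique, Silverman ATAEC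
Lemma V.5.1 = the tree's `existsUnique_tateJ_eq_of_one_lt_norm`) is an `n`-th power in `K`.
[cite: SilvermanATAEC1994, Lemma V.5.1 and Thm. V.5.3 (PDF pp. 406–409)] -/
theorem exists_tateParameter_pow_of_odd_torsion (E : WeierstrassCurve K) [E.IsElliptic]
    (hj : 1 < ‖E.j‖) {n : ℕ} (hn : Odd n) (S : Finset E.toAffine.Point) (hS : ∀ P ∈ S, n • P = 0)
    (hcard : n ^ 2 ≤ S.card) :
    ∃ q ρ : K, q ≠ 0 ∧ ‖q‖ < 1 ∧ tateJ q = E.j ∧ ‖q‖ = ‖E.j‖⁻¹ ∧ ρ ^ n = q := by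
  obtain ⟨q, ⟨hq0, hq, hqj⟩, -⟩ :=
    Literature.NumberTheory.EllipticCurves.existsUnique_tateJ_eq_of_one_lt_norm hj
  obtain ⟨ρ, hρ⟩ := exists_pow_eq_tateParameter_of_odd_torsion E hj hq0 hq hqj hn S hS hcard
  refine ⟨q, ρ, hq0, hq, hqj, ?_, hρ⟩
  rw [← hqj, norm_tateJ_eq hq, inv_inv]

/-- **Multiplicative reduction of EITHER type suffices.** Let `R ⊆ K` be the valuation ring of the
complete ultrametric field `K` (`‖x‖ ≤ 1 ↔ x ∈ R`) and `E/K` an elliptic curve some `K`-model of which is a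
minimal equation with MULTIPLICATIVE reduction (Mathlib `HasMultiplicativeReduction`, split or non-split). If
`E(K)` has `n²` points killed by an odd `n`, then the Tate parameter `q` of `E` is an `n`-th power in `K`
(`|j(E)| > 1` by Silverman AEC VII.5.1 (b) = the tree's `one_lt_norm_j_of_hasMultiplicativeReduction_holds`,
then `exists_tateParameter_pow_of_odd_torsion`). For the abc-iut consumers: with `n = l` this is
`q_v ∈ (K_v̲^×)^l` at every place of (not necessarily split) multiplicative reduction, given `E[l] ⊆ E(K_v̲)`.
[cite: SilvermanATAEC1994, Thm. V.5.3 (PDF pp. 407–409)] -/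
theorem exists_tateParameter_pow_of_odd_torsion_of_hasMultiplicativeReduction
    (R : Type u) [CommRing R] [IsDomain R] [IsDiscreteValuationRing R] [Algebra R K]
    [IsFractionRing R K] (hR : ∀ x : K, ‖x‖ ≤ 1 ↔ x ∈ Set.range (algebraMap R K))
    (E : WeierstrassCurve K) [E.IsElliptic]
    (hmult : ∃ C : VariableChange K, WeierstrassCurve.HasMultiplicativeReduction R (C • E))
    {n : ℕ} (hn : Odd n) (S : Finset E.toAffine.Point) (hS : ∀ P ∈ S, n • P = 0)
    (hcard : n ^ 2 ≤ S.card) :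
    ∃ q ρ : K, q ≠ 0 ∧ ‖q‖ < 1 ∧ tateJ q = E.j ∧ ‖q‖ = ‖E.j‖⁻¹ ∧ ρ ^ n = q := by
  obtain ⟨C, hC⟩ := hmult
  have hj : 1 < ‖E.j‖ := by
    rw [← variableChange_j E C]
    exact one_lt_norm_j_of_hasMultiplicativeReduction_holds R hR (C • E) hC
  exact exists_tateParameter_pow_of_odd_torsion E hj hn S hS hcard

end Tate

end Literature.NumberTheory.EllipticCurves.TateCurve

end
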